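import Mathlib
import HarnessLib
import Literature.GroupTheory.CombinatorialGroupTheory.SignedHurwitzAction

/-!
# Stub `stub_reductionLift` of line `modp-braid-orbits` for crux `ConvexBisection.AcyclicBisectionExists`
(item stmt-SmoothPoincare4-10508, route route-SmoothPoincare4-ConvexBisection)

The reduction / lifting bridge between the integral signed word of vanishing classes (letters in
`ℤ^g ⊕ ℤ^g` with the standard symplectic pairing `stdSymp ℤ g`) and its reduction modulo a large
prime `p` (letters in `(ZMod p)^g ⊕ (ZMod p)^g`, pairing `stdSymp (ZMod p) g`), in the vocabulary
of `Literature/GroupTheory/CombinatorialGroupTheory/SignedHurwitzAction.lean`.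

Statement (`stub_reductionLift`): for an integral word `l` with ω-connected letter set and trivial
signed monodromy, and any `N`, there is a prime `p > N` such that
* (i) every integrally spanning letter set spans after reduction mod `p`;
* (ii) the reduced letter set of `l` is ω-connected;
* (iii) the reduced word has trivial signed monodromy;
* (iv) every word in the mod-`p` signed Hurwitz orbit of the reduction of `l` is the reduction of a
  word in the integral signed Hurwitz orbit of `l`;
* (v) for every integral word `l'` and sign `s`, if the reductions of the sign-`s` classes span
  `(ZMod p)^{2g}` then the same classes read over `ℚ` span `ℚ^{2g}`.

Proof.  All of it is change of coefficients along a ring homomorphism `f : R →+* S`, applied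
coordinatewise (`v ↦ fun i => f (v i)`, so that `redWord p = mapWord` of `Int.castRingHom (ZMod p)`
and `ratWord = mapWord` of `Int.castRingHom ℚ`, definitionally):
* `map_stdSymp`: `f (ω(x, y)) = ω(f x, f y)` (closed formula `stdSymp_apply_eq`), whence signed
  transvections and signed monodromies commute with `f` (`map_transvection`, `map_wordProduct`);
* for surjective `f` (reduction mod `p`), spanning and `wordProduct = 1` descend
  (`span_image_eq_top`, `wordProduct_mapWord_eq_one`) — this gives (i) and (iii);
* a signed Hurwitz move downstairs of `mapWord f l` is, letter by letter, the image of the same move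
  upstairs (`hurwitzStep_lift`, using `List.map_eq_append_iff` / `List.map_eq_cons_iff` to locate
  the moved pair), and induction along `Relation.ReflTransGen` gives (iv) (`hurwitzOrbit_lift`);
* ω-connectedness descends as soon as `f` kills no non-zero pairing `ω(v, w)` of two letters
  (`omegaConnected_image`); choosing `p` larger than every `|ω(v, w)|`, `v, w` letters of `l`
  (a finite set), gives (ii);
* (v) (`span_rat_eq_top_of_span_eq_top`): inside the spanning set of reductions pick a basis
  (`exists_linearIndependent`, `Module.Basis.indexEquiv` to index it by `Fin g ⊕ Fin g`), lift it to
  integer vectors of the class set; the integer matrix they form has a determinant which is a unit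
  mod `p` (`Matrix.linearIndependent_rows_iff_isUnit`, `RingHom.map_det`), hence non-zero, hence
  non-zero in `ℚ`, so the rational rows are linearly independent, hence span `ℚ^{2g}`
  (`LinearIndependent.span_eq_top_of_card_eq_finrank'`).
-/

noncomputable section

-- the prescribed namespace `Summit.<P>.<Sub>.…` duplicates `SmoothPoincare4` (P = Sub)
set_option linter.dupNamespace false

namespace Summit.SmoothPoincare4.SmoothPoincare4.Theorems.AcyclicBisectionExists.ModpBraidOrbits

open Literature.GroupTheory.CombinatorialGroupTheory.SignedHurwitz

section BaseChange

variable {R S : Type*} [CommRing R] [CommRing S] (f : R →+* S) (g : ℕ)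

/-- Closed formula for the standard symplectic pairing:
`ω(x, y) = ∑ᵢ (xᵢ yᵢ' - xᵢ' yᵢ)`. [folklore] -/
theorem stdSymp_apply_eq (x y : Fin g ⊕ Fin g → R) :
    stdSymp R g x y = ∑ i, (x (Sum.inl i) * y (Sum.inr i) - x (Sum.inr i) * y (Sum.inl i)) := by
  rw [Finset.sum_sub_distrib, sub_eq_add_neg]
  simp [stdSymp, Matrix.toLinearMap₂'_apply', dotProduct, Matrix.mulVec,
    Fintype.sum_sum_type, Matrix.fromBlocks, Matrix.one_apply]

/-- The standard symplectic pairing commutes with any change of coefficients. [folklore] -/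
@[simp] theorem map_stdSymp (x y : Fin g ⊕ Fin g → R) :
    f (stdSymp R g x y) = stdSymp S g (fun i => f (x i)) (fun i => f (y i)) := by
  simp [stdSymp_apply_eq, map_sum]

/-- Signs are preserved by ring homomorphisms. [folklore] -/
@[simp] theorem map_sgn (b : Bool) : f (sgn b) = sgn b := by
  cases b <;> simp

/-- Signed transvections commute with change of coefficients. [folklore] -/
theorem map_transvection (x : (Fin g ⊕ Fin g → R) × Bool) (v : Fin g ⊕ Fin g → R) :
    (fun i => f (transvection (stdSymp R g) x v i)) =
      transvection (stdSymp S g) (fun i => f (x.1 i), x.2) (fun i => f (v i)) := by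
  ext i
  simp [transvection_apply, mul_assoc]

/-- Signed monodromies commute with change of coefficients. [folklore] -/
theorem map_wordProduct (l : List ((Fin g ⊕ Fin g → R) × Bool)) (v : Fin g ⊕ Fin g → R) :
    (fun i => f (wordProduct (stdSymp R g) l v i)) =
      wordProduct (stdSymp S g) (mapWord (fun w i => f (w i)) l) (fun i => f (v i)) := by
  induction l generalizing v with
  | nil => rfl
  | cons x l ih =>
    rw [mapWord_cons, wordProduct_cons, wordProduct_cons, Module.End.mul_apply,
      Module.End.mul_apply, ← ih, map_transvection]

/-- Vectors lift along a surjective change of coefficients. [folklore] -/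
theorem exists_vec_lift (hf : Function.Surjective f) {ι : Type*} (y : ι → S) :
    ∃ v : ι → R, (fun i => f (v i)) = y := by
  choose v hv using fun i => hf (y i)
  exact ⟨v, funext hv⟩

/-- Trivial monodromy descends along a surjective change of coefficients. [folklore] -/
theorem wordProduct_mapWord_eq_one (hf : Function.Surjective f)
    {l : List ((Fin g ⊕ Fin g → R) × Bool)} (h : wordProduct (stdSymp R g) l = 1) :
    wordProduct (stdSymp S g) (mapWord (fun w i => f (w i)) l) = 1 := by
  refine LinearMap.ext fun y => ?_
  obtain ⟨v, rfl⟩ := exists_vec_lift f hf y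
  rw [← map_wordProduct, h]
  rfl

/-- Spanning descends along a surjective change of coefficients. [folklore] -/
theorem span_image_eq_top (hf : Function.Surjective f) {ι : Type*} {C : Set (ι → R)}
    (h : Submodule.span R C = ⊤) :
    Submodule.span S ((fun v i => f (v i)) '' C) = ⊤ := by
  refine Submodule.eq_top_iff'.2 fun y => ?_
  obtain ⟨v, rfl⟩ := exists_vec_lift f hf y
  have hv : v ∈ Submodule.span R C := h ▸ Submodule.mem_top
  induction hv using Submodule.span_induction with
  | mem x hx => exact Submodule.subset_span ⟨x, hx, rfl⟩
  | zero =>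
    have : (fun i => f ((0 : ι → R) i)) = 0 := funext fun i => by simp
    exact this ▸ Submodule.zero_mem _
  | add x y _ _ hx hy =>
    have : (fun i => f ((x + y) i)) = (fun i => f (x i)) + fun i => f (y i) :=
      funext fun i => by simp
    exact this ▸ Submodule.add_mem _ hx hy
  | smul c x _ hx =>
    have : (fun i => f ((c • x) i)) = f c • fun i => f (x i) := funext fun i => by simp
    exact this ▸ Submodule.smul_mem _ _ hx

/-- ω-connectedness descends along a change of coefficients that kills no non-zero pairing of
the set. [folklore] -/
theorem omegaConnected_image {C : Set (Fin g ⊕ Fin g → R)}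
    (hC : OmegaConnected (stdSymp R g) C)
    (hf : ∀ v ∈ C, ∀ w ∈ C, stdSymp R g v w ≠ 0 → f (stdSymp R g v w) ≠ 0) :
    OmegaConnected (stdSymp S g) ((fun v i => f (v i)) '' C) := by
  intro T' hT' hne hneq
  obtain ⟨v, ⟨hvC, hvT⟩, w, ⟨hwC, hwT⟩, hvw⟩ := hC {v ∈ C | (fun i => f (v i)) ∈ T'}
    (fun v hv => hv.1)
    (by
      obtain ⟨y, hy⟩ := hne
      obtain ⟨v, hv, rfl⟩ := hT' hy
      exact ⟨v, hv, hy⟩)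
    (by
      intro hTC
      refine hneq (Set.Subset.antisymm hT' ?_)
      rintro _ ⟨v, hv, rfl⟩
      rw [← hTC] at hv
      exact hv.2)
  refine ⟨fun i => f (v i), hvT, fun i => f (w i),
    ⟨⟨w, hwC, rfl⟩, fun hw => hwT ⟨hwC, hw⟩⟩, ?_⟩
  rw [← map_stdSymp]
  exact hf v hvC w hwC hvw

/-- One signed Hurwitz move downstairs lifts to one signed Hurwitz move upstairs. [folklore] -/
theorem hurwitzStep_lift (l : List ((Fin g ⊕ Fin g → R) × Bool))
    {m : List ((Fin g ⊕ Fin g → S) × Bool)}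
    (h : HurwitzStep (stdSymp S g) (mapWord (fun v i => f (v i)) l) m) :
    ∃ l', HurwitzStep (stdSymp R g) l l' ∧ mapWord (fun v i => f (v i)) l' = m := by
  obtain ⟨pre, suf, a, b, hl, hm⟩ := h
  obtain ⟨pre₀, rest, rfl, rfl, hrest⟩ := List.map_eq_append_iff.mp hl
  obtain ⟨a₀, rest₁, rfl, rfl, hrest₁⟩ := List.map_eq_cons_iff.mp hrest
  obtain ⟨b₀, suf₀, rfl, rfl, rfl⟩ := List.map_eq_cons_iff.mp hrest₁
  rcases hm with rfl | rfl
  · refine ⟨pre₀ ++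
        (b₀.1 + (sgn a₀.2 * stdSymp R g a₀.1 b₀.1) • a₀.1, b₀.2) :: a₀ :: suf₀,
      ⟨pre₀, suf₀, a₀, b₀, rfl, Or.inl rfl⟩, ?_⟩
    simp only [mapWord, List.map_append, List.map_cons]
    congr 3
    ext i
    simp [mul_assoc]
  · refine ⟨pre₀ ++
        b₀ :: (a₀.1 - (sgn b₀.2 * stdSymp R g b₀.1 a₀.1) • b₀.1, a₀.2) :: suf₀,
      ⟨pre₀, suf₀, a₀, b₀, rfl, Or.inr rfl⟩, ?_⟩
    simp only [mapWord, List.map_append, List.map_cons]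
    congr 4
    ext i
    simp [mul_assoc]

/-- The Hurwitz orbit downstairs of a reduced word is the reduction of the Hurwitz orbit
upstairs. [folklore] -/
theorem hurwitzOrbit_lift (l : List ((Fin g ⊕ Fin g → R) × Bool))
    {m : List ((Fin g ⊕ Fin g → S) × Bool)}
    (h : HurwitzOrbit (stdSymp S g) (mapWord (fun v i => f (v i)) l) m) :
    ∃ l', HurwitzOrbit (stdSymp R g) l l' ∧ mapWord (fun v i => f (v i)) l' = m := by
  unfold HurwitzOrbit at h
  induction h with
  | refl => exact ⟨l, HurwitzOrbit.refl _ _, rfl⟩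
  | tail _ hstep ih =>
    obtain ⟨l₁, h₁, rfl⟩ := ih
    obtain ⟨l₂, h₂, rfl⟩ := hurwitzStep_lift f g l₁ hstep
    exact ⟨l₂, h₁.trans h₂.orbit, rfl⟩

end BaseChange

section SpanLift

/-- Integer vectors whose reductions in a field `K` span `K^ι` span `ℚ^ι` over `ℚ`: a maximal
minor which is non-zero in `K` is a non-zero integer. [folklore] -/
theorem span_rat_eq_top_of_span_eq_top {ι : Type*} [Fintype ι] {K : Type*} [Field K]
    {C : Set (ι → ℤ)} (h : Submodule.span K ((fun v i => (v i : K)) '' C) = ⊤) :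
    Submodule.span ℚ ((fun v i => (v i : ℚ)) '' C) = ⊤ := by
  classical
  obtain ⟨b, hbC, hbspan, hbli⟩ := exists_linearIndependent K ((fun v i => (v i : K)) '' C)
  rw [h] at hbspan
  let B : Module.Basis b K (ι → K) := Module.Basis.mk hbli (by simp [hbspan])
  let e : b ≃ ι := B.indexEquiv (Pi.basisFun K ι)
  choose u huC hu using fun i : ι => hbC (e.symm i).2
  let A : Matrix ι ι ℤ := Matrix.of u
  have hliK : LinearIndependent K (A.map (Int.castRingHom K)).row := by
    have : (A.map (Int.castRingHom K)).row = (fun x : b => (x : ι → K)) ∘ e.symm :=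
      funext fun i => hu i
    rw [this]
    exact hbli.comp _ e.symm.injective
  have hdetZ : A.det ≠ 0 := fun h0 =>
    ((Matrix.isUnit_iff_isUnit_det _).mp (Matrix.linearIndependent_rows_iff_isUnit.mp hliK)).ne_zero
      (by rw [← RingHom.mapMatrix_apply, ← RingHom.map_det, h0, map_zero])
  have hliQ : LinearIndependent ℚ (A.map (Int.castRingHom ℚ)).row := by
    refine Matrix.linearIndependent_rows_iff_isUnit.mpr
      ((Matrix.isUnit_iff_isUnit_det _).mpr (isUnit_iff_ne_zero.mpr ?_))
    rw [← RingHom.mapMatrix_apply, ← RingHom.map_det, eq_intCast]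
    exact Int.cast_ne_zero.mpr hdetZ
  have hspanQ := hliQ.span_eq_top_of_card_eq_finrank' (by simp)
  rw [eq_top_iff, ← hspanQ]
  refine Submodule.span_mono ?_
  rintro _ ⟨i, rfl⟩
  exact ⟨u i, huC i, funext fun j => by simp [A]⟩

end SpanLift

/-- **Stub `stub_reductionLift` (reduction mod `p` and lifting back).** For an integral signed
word `l` (letters in `ℤ^g ⊕ ℤ^g`, pairing `stdSymp ℤ g`) with ω-connected letter set and trivial
signed monodromy, and any bound `N`, there is a prime `p > N` such that: (i) integral spanning of
any letter set descends to `ZMod p`-spanning of its reduction; (ii) the reduced letter set of `l` is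
ω-connected; (iii) the reduced word has trivial signed monodromy; (iv) the mod-`p` signed Hurwitz
orbit of the reduction of `l` is the reduction of the integral signed Hurwitz orbit of `l`;
(v) `ZMod p`-spanning of the reduced sign-`s` classes of any integral word implies `ℚ`-spanning of
the same classes read over `ℚ`.  Proof: `p` is any prime exceeding `N` and all `|ω(v, w)|` for
letters `v, w` of `l`; (i), (iii), (iv) hold for every `p` (coefficient change commutes with the
pairing, with transvections and with Hurwitz moves, and reduction is surjective), (ii) because `p`
kills no non-zero pairing of letters, (v) by a determinant which is a unit mod `p`, hence a
non-zero integer. [folklore] -/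
theorem stub_reductionLift :
    ∀ (g : ℕ) (l : List ((Fin g ⊕ Fin g → ℤ) × Bool)) (N : ℕ),
      OmegaConnected (stdSymp ℤ g) (letters l) → wordProduct (stdSymp ℤ g) l = 1 →
      ∃ p : ℕ, p.Prime ∧ N < p ∧
        (∀ l₀ : List ((Fin g ⊕ Fin g → ℤ) × Bool), Submodule.span ℤ (letters l₀) = ⊤ →
          Submodule.span (ZMod p) (letters (redWord p l₀)) = ⊤) ∧
        OmegaConnected (stdSymp (ZMod p) g) (letters (redWord p l)) ∧
        wordProduct (stdSymp (ZMod p) g) (redWord p l) = 1 ∧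
        (∀ m : List ((Fin g ⊕ Fin g → ZMod p) × Bool),
          HurwitzOrbit (stdSymp (ZMod p) g) (redWord p l) m →
          ∃ l' : List ((Fin g ⊕ Fin g → ℤ) × Bool), HurwitzOrbit (stdSymp ℤ g) l l' ∧ redWord p l' = m) ∧
        (∀ (l' : List ((Fin g ⊕ Fin g → ℤ) × Bool)) (s : Bool),
          Submodule.span (ZMod p) (classesOfSign (redWord p l') s) = ⊤ →
          Submodule.span ℚ (classesOfSign (ratWord l') s) = ⊤) := by
  intro g l N hconn hprod
  -- (1) a bound `B` for the pairings of the (finitely many) letters of `l`, and a prime beyond it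
  have hfin : (letters l).Finite :=
    (l.finite_toSet.image Prod.fst).subset fun v ⟨s, hs⟩ => ⟨(v, s), hs, rfl⟩
  obtain ⟨B, hB⟩ := ((hfin.prod hfin).image fun q => (stdSymp ℤ g q.1 q.2).natAbs).bddAbove
  have hB' : ∀ v ∈ letters l, ∀ w ∈ letters l, (stdSymp ℤ g v w).natAbs ≤ B :=
    fun v hv w hw => hB ⟨(v, w), ⟨hv, hw⟩, rfl⟩
  obtain ⟨p, hle, hp⟩ := Nat.exists_infinite_primes (max N B + 1)
  haveI : Fact p.Prime := ⟨hp⟩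
  have hNp : N < p := lt_of_lt_of_le (Nat.lt_succ_of_le (le_max_left N B)) hle
  have hBp : B < p := lt_of_lt_of_le (Nat.lt_succ_of_le (le_max_right N B)) hle
  have hred : ∀ l' : List ((Fin g ⊕ Fin g → ℤ) × Bool),
      redWord p l' = mapWord (fun v i => Int.castRingHom (ZMod p) (v i)) l' := fun _ => rfl
  have hsurj : Function.Surjective (Int.castRingHom (ZMod p)) := ZMod.ringHom_surjective _
  refine ⟨p, hp, hNp, fun l₀ h₀ => ?_, ?_, ?_, fun m hm => ?_, fun l' s hs => ?_⟩
  · -- (2)(i) spanning descends (reduction is surjective)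
    rw [hred, letters_mapWord]
    exact span_image_eq_top (Int.castRingHom (ZMod p)) hsurj h₀
  · -- (2)(ii) ω-connectedness descends (`p` exceeds every `|ω(v, w)|`)
    rw [hred, letters_mapWord]
    refine omegaConnected_image (Int.castRingHom (ZMod p)) g hconn
      fun v hv w hw hne h0 => hne ?_
    rw [eq_intCast, ZMod.intCast_zmod_eq_zero_iff_dvd] at h0
    exact Int.eq_zero_of_dvd_of_natAbs_lt_natAbs h0
      (by rw [Int.natAbs_natCast]; exact (hB' v hv w hw).trans_lt hBp)
  · -- (2)(iii) trivial monodromy descends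
    rw [hred]
    exact wordProduct_mapWord_eq_one (Int.castRingHom (ZMod p)) g hsurj hprod
  · -- (2)(iv) the mod-`p` Hurwitz orbit lifts to the integral one
    rw [hred] at hm
    obtain ⟨l', h₁, h₂⟩ := hurwitzOrbit_lift (Int.castRingHom (ZMod p)) g l hm
    exact ⟨l', h₁, (hred l').trans h₂⟩
  · -- (2)(v) mod-`p` spanning of a class set lifts to `ℚ`-spanning
    rw [redWord, classesOfSign_mapWord] at hs
    rw [ratWord, classesOfSign_mapWord]
    exact span_rat_eq_top_of_span_eq_top hs

end Summit.SmoothPoincare4.SmoothPoincare4.Theorems.AcyclicBisectionExists.ModpBraidOrbits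

end
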